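import Summits.HodgeConjecture.HodgeConjecture.Theorems.F0P3GenAdmissible            -- ★-pending p803597 (F0P3-p03 (g4)): `isAdmissibleGK_subrepresentation_of_le_gen`
import Summits.HodgeConjecture.HodgeConjecture.Theorems.F0P3CotangentFormValueMap    -- ★ B1′ (F0P3-p01 (g3)): `valueMap_hol`; ★ `exists_valueMap`, `valueMap_apply_upqUnit`
import HarnessLib

/-!
# Crux `H413` — RUNG 1½ «ISOTYPY FROM A NULL CORE», brick B4d at the CM pin: the module generated by the coordinate classes of a holomorphic
# cotangent form is ADMISSIBLE

Floor-0 programme P3 «U3-mult», seat F0P3-p03 (g4); crux item stmt-HodgeConjecture-24833 (`HCCMUnconditional.H413`); rung-1 line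
`Cruxes/H413/Lines/F0_U3LettersRung1.lean` ed. 2.1, stub `stub_F1a_cm : StubF1aCM`; road «F1a in-house at the pin» (F0P3-p02 (g3)).  This file
DISCHARGES the residual binder `hadm` of F0P3-p02 (g3)'s CM assembly `F0P3HolFormArchIsotypy.archIsotypy_of_hol` (B5c, rf 302ceb79 :270–300, GO
2026-08-31T02:25:39Z), stated here as the conclusion of `hadm_cm` TOKEN FOR TOKEN, from the generic admissibility theorem ★
`F0P3GenAdmissible.isAdmissibleGK_subrepresentation_of_le_gen` («every `K`-stable `U ≤ gen ρ𝔤 μ E` is admissible when `E` is a finite-dimensional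
`z₀`-eigenspace»).  HC_CM is proved only modulo the printed citations until rung 0 closes.

At the CM pin (`(ρK, ρ𝔤) = (P.archRepKCM, P.archRepLieCM) ι T hT` on `P.archModuleCM ι T hT`, ★ `P.isGKModule_archModuleCM`; `μ = i`): the coordinate
classes `v₀, v₁` of `Φ ∈ holCotForms` are `z₀`-eigenvectors of weight `i` (conclusion (hwt) of ★ B1′ `valueMap_hol`: `ρ𝔤 z₀ (φ X) = i • φ X`, and
`vⱼ = φ (X_{E_{j0}})`, ★ `valueMap_apply_upqUnit`), so `E = span {v₀, v₁}` is a finite-dimensional subspace of `z₀`-weight `i`, and every `K`-stable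
`U = gen ρ𝔤 i E` is admissible: **`hadm_cm`** (§2; §1 `upqZ0_apply_of_mem_span` is the generic weight bookkeeping). [cite: BorelWallach2000, 0 §2.4; II §4.1; VI 4.8 (3)] [cite: KnappVogan1995, §I.3 (before Prop. 1.63)]
[cite: HarishChandraTAMS1953, §9]

No definition, no sorry, no named fact; `--supports stmt-HodgeConjecture-24833`.
-/

-- Mathlib idiom (as in ★ `GKModules`, the T6 layer, B1 and B1′): commutator bracket on `Module.End`
attribute [local instance 100] LieRing.ofAssociativeRing

set_option autoImplicit false
-- the mandated namespace repeats `HodgeConjecture.HodgeConjecture`, as in every `Theorems/*.lean` of this sub-problem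
set_option linter.dupNamespace false

noncomputable section

open scoped Matrix MatrixGroups ComplexConjugate ENNReal ComplexOrder
open MeasureTheory NumberField

namespace Summit.HodgeConjecture.HodgeConjecture.Cruxes.H413.F0P3HolFormAdmissible

open Literature.NumberTheory.Automorphic Literature.NumberTheory.Automorphic.UnitaryGroup
open Literature.NumberTheory.Automorphic.UnitaryGroup.CotangentForms
open Literature.RepresentationTheory.KonnoKonno2007 Literature.RepresentationTheory.KonnoKonno2007.RealDualPair
open Literature.RepresentationTheory.KonnoKonno2007.RealDualPair.UForm
open Literature.RepresentationTheory.BorelWallach2000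
open Literature.Geometry.ComplexHyperbolic.BallModel (J)
open Summit.HodgeConjecture.HodgeConjecture.Cruxes.H413.F0P3bPNullGeneration (gen)
open Summit.HodgeConjecture.HodgeConjecture.Cruxes.H413.F0P3GenAdmissible (isAdmissibleGK_subrepresentation_of_le_gen)
open Summit.HodgeConjecture.HodgeConjecture.Cruxes.H413.F0P3ValueMapOfFrameVectors (exists_valueMap valueMap_apply_upqUnit)
open Summit.HodgeConjecture.HodgeConjecture.Cruxes.H413.F0P3CotangentFormL2Span (memLp_toQuotFun_apply)
open Summit.HodgeConjecture.HodgeConjecture.Cruxes.H413.F0P3CotangentFormValueMap (valueMap_hol)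
open Summit.HodgeConjecture.HodgeConjecture.Cruxes.H413.F0P3HolProjectionReduction (compactSpace_automorphicQuotient_cm)

/-! ## §1 (generic) The span of the frame of a typed value map of `z₀`-weight `c` has `z₀`-weight `c` -/

section Generic

variable {V : Type} [AddCommGroup V] [Module ℂ V] {ρ𝔤 : (uFormGroup (Fin 2) (Fin 1)).lie →ₗ⁅ℝ⁆ Module.End ℂ V}

/-- **The frame vectors of a typed value map of `z₀`-weight `c` span a subspace of `z₀`-weight `c`** (`vⱼ = φ (X_{E_{j0}})`, ★ `valueMap_apply_upqUnit`;
the eigenspace is a subspace). [cite: BorelWallach2000, II §4.1; VI 4.8 (3)] -/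
theorem upqZ0_apply_of_mem_span (v : Fin 2 → V) (φ : (uFormGroup (Fin 2) (Fin 1)).lie →ₗ[ℝ] V)
    (hφ : ∀ Y : (uFormGroup (Fin 2) (Fin 1)).lie,
      φ Y = ∑ j : Fin 2, ((Y : Matrix (Fin 2 ⊕ Fin 1) (Fin 2 ⊕ Fin 1) ℂ) (Sum.inl j) (Sum.inr 0)) • v j)
    {c : ℂ} (hwt : ∀ X : (uFormGroup (Fin 2) (Fin 1)).lie, ρ𝔤 (upqZ0 (Fin 2) (Fin 1)) (φ X) = c • φ X) :
    ∀ e ∈ Submodule.span ℂ (Set.range v), ρ𝔤 (upqZ0 (Fin 2) (Fin 1)) e = c • e := by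
  have hφ' : ∀ Y : (uFormGroup (Fin 2) (Fin 1)).lie, φ Y = ∑ j : Fin 2,
      LinearMap.id (R := ℝ) ((Y : Matrix (Fin 2 ⊕ Fin 1) (Fin 2 ⊕ Fin 1) ℂ) (Sum.inl j) (Sum.inr 0)) • v j := hφ
  have hle : Submodule.span ℂ (Set.range v) ≤ Module.End.eigenspace (ρ𝔤 (upqZ0 (Fin 2) (Fin 1))) c := by
    refine Submodule.span_le.2 ?_
    rintro _ ⟨j, rfl⟩
    have hX : φ (upqUnit (j, (0 : Fin 1)) 1) = v j := by
      rw [valueMap_apply_upqUnit LinearMap.id v φ hφ' (j, 0) 1, LinearMap.id_apply, one_smul]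
    rw [SetLike.mem_coe, Module.End.mem_eigenspace_iff, ← hX]
    exact hwt _
  exact fun e he => Module.End.mem_eigenspace_iff.1 (hle he)

end Generic

/-! ## §2 The CM pin: admissibility of the module generated by the coordinate classes of a holomorphic cotangent form -/

variable {L : Type} [Field L] [NumberField L] [IsCMField L] (ι : L →+* ℂ) {H : Matrix (Fin 3) (Fin 3) L}
  (T : GL (Fin 3) ℂ) (hT : (T : Matrix (Fin 3) (Fin 3) ℂ)ᴴ * H.map ι * (T : Matrix (Fin 3) (Fin 3) ℂ) = J)

/-- **The module generated by the coordinate classes of a holomorphic cotangent form is ADMISSIBLE** — the residual binder `hadm` of F0P3-p02 (g3)'s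
`F0P3HolFormArchIsotypy.archIsotypy_of_hol` VERBATIM: for a discrete automorphic `P` of `U(H)(𝔸_{L⁺})` (CM frame `(L, ι, H, T, hT)`, `H` definite away
from `ι`, `[L⁺ : ℚ] ≥ 2`) and `Φ ∈ holCotForms`, for every choice `v` of coordinate classes of `Φ` in `P.archModuleCM ι T hT` and every `K`-stable
`U = gen (P.archRepLieCM ι T hT) i (span (range v))`, the restricted `K`-action on `U` is admissible (★ `F0P3GenAdmissible.isAdmissibleGK_subrepresentation_of_le_gen`
with `E := span (range v)`, finite-dimensional of `z₀`-weight `i`). [cite: BorelWallach2000, 0 §2.4; II §4.1] [cite: KnappVogan1995, §I.3 (before Prop. 1.63)]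
[cite: HarishChandraTAMS1953, §9] -/
theorem hadm_cm
    (hdef : ∀ τ' : L →+* ℂ, InfinitePlace.mk τ' ≠ InfinitePlace.mk ι → (H.map τ').PosDef) (h2 : 2 ≤ Module.finrank ℚ ↥(maximalRealSubfield L))
    (μ : Measure (adelicGroupData (↥(maximalRealSubfield L)) L (IsCMField.complexConj L) 3 H).automorphicQuotient)
    [(adelicGroupData (↥(maximalRealSubfield L)) L (IsCMField.complexConj L) 3 H).IsAutomorphicMeasure μ]
    (P : DiscreteAutomorphicRep (adelicGroupData (↥(maximalRealSubfield L)) L (IsCMField.complexConj L) 3 H) μ)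
    {Φ : (adelicGroupData (↥(maximalRealSubfield L)) L (IsCMField.complexConj L) 3 H).Adelic → (Fin 2 → ℂ)}
    (hΦ : Φ ∈ holCotForms (↥(maximalRealSubfield L)) L (IsCMField.complexConj L) 3 H (cmArchSection L ι H T hT) (cmCompactFactor L ι H T hT)) :
    ∀ v : Fin 2 → P.archModuleCM ι T hT,
      (∀ j : Fin 2, ∃ hm : MemLp (toQuotFun (adelicGroupData (↥(maximalRealSubfield L)) L (IsCMField.complexConj L) 3 H) fun x => Φ x j) 2 μ,
        (((v j : P.archModuleCM ι T hT) : P.space.toSubmodule) : (adelicGroupData (↥(maximalRealSubfield L)) L (IsCMField.complexConj L) 3 H).L2 μ) =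
          hm.toLp _) →
      ∀ (U : Submodule ℂ (P.archModuleCM ι T hT)), U = gen (P.archRepLieCM ι T hT) Complex.I (Submodule.span ℂ (Set.range v)) →
        ∀ hK : ∀ k : (uFormGroup (Fin 2) (Fin 1)).maximalCompact, U ≤ U.comap (P.archRepKCM ι T hT k),
          @IsAdmissibleGK ℂ _ _ _ _ _ (Fin 2 ⊕ Fin 1) _ _ (uFormGroup (Fin 2) (Fin 1)) ↥U U.addCommGroup U.module
            ((P.archRepKCM ι T hT).subrepresentation U hK) := by
  haveI := compactSpace_automorphicQuotient_cm hdef h2 (L := L) (ι := ι) (H := H)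
  intro v hv U hU hK
  have hv' : ∀ j : Fin 2, (((v j : P.archModuleCM ι T hT) : P.space.toSubmodule) :
      (adelicGroupData (↥(maximalRealSubfield L)) L (IsCMField.complexConj L) 3 H).L2 μ) =
      (memLp_toQuotFun_apply ι T hT (μ := μ) hΦ j).toLp
        (toQuotFun (adelicGroupData (↥(maximalRealSubfield L)) L (IsCMField.complexConj L) 3 H) fun x => Φ x j) := by
    intro j
    obtain ⟨hm, h⟩ := hv j
    exact h
  obtain ⟨φ, hφ⟩ := exists_valueMap LinearMap.id v
  have hφ' : ∀ Y : (uFormGroup (Fin 2) (Fin 1)).lie,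
      φ Y = ∑ j : Fin 2, ((Y : Matrix (Fin 2 ⊕ Fin 1) (Fin 2 ⊕ Fin 1) ℂ) (Sum.inl j) (Sum.inr 0)) • v j := hφ
  obtain ⟨-, -, -, hwt, -, -⟩ := valueMap_hol ι T hT P hΦ v hv' φ hφ'
  have hw := upqZ0_apply_of_mem_span (ρ𝔤 := P.archRepLieCM ι T hT) v φ hφ' hwt
  haveI : FiniteDimensional ℂ (Submodule.span ℂ (Set.range v)) := FiniteDimensional.span_of_finite ℂ (Set.finite_range v)
  exact isAdmissibleGK_subrepresentation_of_le_gen (P.isGKModule_archModuleCM ι T hT) Complex.I_mul_I hw hK hU.le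

end Summit.HodgeConjecture.HodgeConjecture.Cruxes.H413.F0P3HolFormAdmissible

end
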